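import Literature.Topology.FourManifolds.NullhomotopicNormalFraming
import Literature.Topology.FourManifolds.CodimTwoNormalEuler

/-!
# Kirby's plane field of a codimension-two submanifold carries a continuous rotation field
(registered helper `helper_planeFieldRotation` of the stub `stub_normalWitnessTransfer`,
line `cross-cap-laurent`, crux `GromovRecognitionRelEnd`, item stmt-SmoothPoincare4-11009)

Setting (`Literature/Topology/FourManifolds/NullhomotopicNormalFraming.lean`): `D : CodimTwoData k X
S ℝᵐ` is a compact `k`-manifold `b : S → X` in a `(k+2)`-manifold read in a Whitney embedding
`e : X → ℝᵐ`, `J` a rotation field of its normal planes `F y`, `ε` a tube radius, `0 < δ < δ₀ ≤ ε`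
collar radii with the tautological section `w = wVec` nonzero at the points of `e(X)` at distance
`∈ (0, δ₀)` from `f(S)`.  Kirby's plane field `P_z = D.planeField J ε δ z` (R. C. Kirby, *The
Topology of 4-Manifolds* (1989), Ch. VIII, proof of Thm. 2, pp. 44–45) is the idempotent of
`ℝᵐ × ℝ²` equal to `(p, q) ↦ (Q_{x(z)} p, 0)` within `δ/2` of `f(S)`, to `(p, q) ↦ (0, q)` beyond
`δ`, and on the collar to the projection onto the plane of Kirby's pair `fᵢ = (cos θ uᵢ, sin θ eᵢ)`,
`u = (w/‖w‖, Jw/‖w‖)`, orthonormal for the pairing `B(x, y) = ⟪x.1, y.1⟫ + ⟪x.2, y.2⟫`.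

We prove `helper_planeFieldRotation`: on `W = e(X) ∪ {dist(·, f S) > δ}` the field `P` is
continuous, and there is a field `Rot` of endomorphisms, continuous on `W`, forming with `P` at
every `z ∈ W` an *oriented plane field* (`P² = P`, `P Rot = Rot P = Rot`, `Rot² = -P`,
`B(Rot v, P v) = 0`, `B(Rot v, Rot v) = B(P v, P v)`, `P ≠ 0`, coordinate formula in the basis
`(v, Rot v)`), equal to `(p, q) ↦ (J Q p, 0)` within `δ/2` of `f(S)` and to `(p, q) ↦ (0, (-q₁, q₀))`
beyond `δ` (on `W` only: at a collar point off `e(X)` with `w = 0`, `P_z = 0 ⊕ sin²θ` is not an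
idempotent).  Proof: for a `B`-orthonormal pair `(f₀, f₁)` the operators `P v = Σ B(v, fᵢ) fᵢ`,
`R v = B(v, f₀) f₁ - B(v, f₁) f₀` satisfy the eight axioms (`opf_of_pair`, a `2 × 2` computation);
the three pieces are of this form (inner: `fᵢ = (uᵢ, 0)`, `u₀ ∈ F_x` a unit vector, `u₁ = J u₀`,
using `J² = -1` on `F` — polarise `⟪J v, v⟫ = 0` — and `Q = Σ ⟪uᵢ, ·⟫ uᵢ` as `dim F = 2`; collar:
Kirby's pair, `w ≠ 0` as `z ∈ e(X)`; outer: `fᵢ = (0, eᵢ)`), and `Rot` is glued from the three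
rotations exactly as `P` is in the tree's `continuousOn_planeField`.

References: R. C. Kirby, *The Topology of 4-Manifolds*, LNM 1374, Springer (1989), Ch. VIII,
Thm. 2 and its proof, pp. 44–45 [Kirby1989]; J. Milnor, J. Stasheff, *Characteristic Classes*,
Ann. of Math. Studies 76 (1974), §2 (oriented plane bundles) [MilnorStasheff1974].
No new definitions.
-/

open scoped Manifold ContDiff Topology RealInnerProductSpace
open Set Function Metric Module Filter
open Literature.Topology.FourManifolds Literature.Topology.FourManifolds.NormalEuler
  Literature.Topology.FourManifolds.CodimTwoData

-- the prescribed namespace `Summit.<P>.<Sub>.…` duplicates `SmoothPoincare4` (P = Sub)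
set_option linter.dupNamespace false

noncomputable section

namespace Summit.SmoothPoincare4.SmoothPoincare4.Theorems.GromovRecognitionRelEnd.CrossCapLaurent

/-- Local notation: `𝔽 m = ℝᵐ × ℝ²`, the fibre carrying the plane field. -/
local notation "𝔽 " m:arg => (EuclideanSpace ℝ (Fin m) × EuclideanSpace ℝ (Fin 2))
/-- Local notation: the pairing `B(x, y) = ⟪x.1, y.1⟫ + ⟪x.2, y.2⟫` on `ℝᵐ × ℝ²`. -/
local notation "⦅" x ", " y "⦆" =>
  (inner ℝ (Prod.fst x) (Prod.fst y) + inner ℝ (Prod.snd x) (Prod.snd y))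
/-- Local notation: Kirby's pair `fᵢ = (c uᵢ, s eᵢ)` of the collar. -/
local notation "KP[" m ", " u ", " c ", " s ", " i "]" =>
  ((c • u i, s • EuclideanSpace.single i (1 : ℝ)) : 𝔽 m)
/-- Local notation: the collar rotation `v ↦ B(v, f₀) f₁ - B(v, f₁) f₀` of Kirby's pair. -/
local notation "colRot[" m ", " u ", " c ", " s "]" =>
  (ContinuousLinearMap.smulRight (mixCoeff u c s 0) KP[m, u, c, s, 1] -
    ContinuousLinearMap.smulRight (mixCoeff u c s 1) KP[m, u, c, s, 0])
/-- Local notation: the outer rotation `(p, q) ↦ (0, (-q₁, q₀))` (collar rotation at `θ = π/2`). -/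
local notation "outRot[" m "]" =>
  colRot[m, (0 : Fin 2 → EuclideanSpace ℝ (Fin m)), (0 : ℝ), (1 : ℝ)]

namespace HelperPlaneFieldRotation

/-! ### Linear algebra of a `B`-orthonormal pair -/

section LinAlg

variable {m : ℕ}

/-- Bilinearity of the pairing in the left slot. [folklore] -/
theorem pairing_combo_left (f₀ f₁ w : 𝔽 m) (x y : ℝ) :
    ⦅x • f₀ + y • f₁, w⦆ = x * ⦅f₀, w⦆ + y * ⦅f₁, w⦆ := by
  simp only [Prod.fst_add, Prod.snd_add, Prod.smul_fst, Prod.smul_snd, inner_add_left,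
    real_inner_smul_left]
  ring

/-- **The oriented-plane-field axioms for a `B`-orthonormal pair**: `P v = Σ B(v, fᵢ) fᵢ` and
`R v = B(v, f₀) f₁ - B(v, f₁) f₀` satisfy `P² = P`, `PR = RP = R`, `R² = -P`, `B(Rv, Pv) = 0`,
`B(Rv, Rv) = B(Pv, Pv)`, `P ≠ 0`, and the coordinate formula in the basis `(v, Rv)`. [folklore] -/
theorem opf_of_pair {P R : 𝔽 m →L[ℝ] 𝔽 m} {f₀ f₁ : 𝔽 m}
    (h00 : ⦅f₀, f₀⦆ = 1) (h01 : ⦅f₀, f₁⦆ = 0) (h11 : ⦅f₁, f₁⦆ = 1)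
    (hP : ∀ v, P v = ⦅v, f₀⦆ • f₀ + ⦅v, f₁⦆ • f₁)
    (hR : ∀ v, R v = ⦅v, f₀⦆ • f₁ - ⦅v, f₁⦆ • f₀) :
    (∀ v, P (P v) = P v) ∧ (∀ v, P (R v) = R v) ∧ (∀ v, R (P v) = R v) ∧
    (∀ v, R (R v) = - P v) ∧ (∀ v, ⦅R v, P v⦆ = 0) ∧ (∀ v, ⦅R v, R v⦆ = ⦅P v, P v⦆) ∧ P ≠ 0 ∧
    (∀ v w', P v = v → v ≠ 0 → P w' = w' →
      w' = (⦅w', v⦆ / ⦅v, v⦆) • v + (⦅w', R v⦆ / ⦅v, v⦆) • R v) := by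
  have h10 : ⦅f₁, f₀⦆ = 0 := by rw [real_inner_comm f₀.1, real_inner_comm f₀.2]; exact h01
  have hR' : ∀ v, R v = (-⦅v, f₁⦆) • f₀ + ⦅v, f₀⦆ • f₁ := fun v => by rw [hR v, neg_smul]; abel
  have hPf0 : ∀ v, ⦅P v, f₀⦆ = ⦅v, f₀⦆ := fun v => by rw [hP v, pairing_combo_left, h00, h10]; ring
  have hPf1 : ∀ v, ⦅P v, f₁⦆ = ⦅v, f₁⦆ := fun v => by rw [hP v, pairing_combo_left, h01, h11]; ring
  have hRf0 : ∀ v, ⦅R v, f₀⦆ = -⦅v, f₁⦆ := fun v => by rw [hR' v, pairing_combo_left, h00, h10]; ring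
  have hRf1 : ∀ v, ⦅R v, f₁⦆ = ⦅v, f₀⦆ := fun v => by rw [hR' v, pairing_combo_left, h01, h11]; ring
  have hcc : ∀ x y x' y' : ℝ, ⦅x • f₀ + y • f₁, x' • f₀ + y' • f₁⦆ = x * x' + y * y' := by
    intro x y x' y'
    simp only [Prod.fst_add, Prod.snd_add, Prod.smul_fst, Prod.smul_snd, inner_add_left,
      inner_add_right, real_inner_smul_left, real_inner_smul_right]
    linear_combination (x * x') * h00 + (x * y') * h01 + (y * x') * h10 + (y * y') * h11
  refine ⟨fun v => ?_, fun v => ?_, fun v => ?_, fun v => ?_, fun v => ?_, fun v => ?_, ?_, ?_⟩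
  · rw [hP (P v), hPf0, hPf1, ← hP v]
  · rw [hP (R v), hRf0, hRf1, hR' v]
  · rw [hR (P v), hPf0, hPf1, ← hR v]
  · rw [hR' (R v), hRf0, hRf1, hP v, neg_smul, neg_smul, ← neg_add]
  · rw [hR' v, hP v, hcc]; ring
  · rw [hR' v, hP v, hcc, hcc]; ring
  · intro h
    have hf : f₀ = 0 := by
      simpa [h] using (show P f₀ = f₀ by rw [hP, h00, h01, one_smul, zero_smul, add_zero]).symm
    simp [hf] at h00
  · intro v w' hv hv0 hw'
    obtain ⟨a, ha⟩ : ∃ a, ⦅v, f₀⦆ = a := ⟨_, rfl⟩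
    obtain ⟨b, hb⟩ : ∃ b, ⦅v, f₁⦆ = b := ⟨_, rfl⟩
    obtain ⟨a', ha'⟩ : ∃ a', ⦅w', f₀⦆ = a' := ⟨_, rfl⟩
    obtain ⟨b', hb'⟩ : ∃ b', ⦅w', f₁⦆ = b' := ⟨_, rfl⟩
    have hve : v = a • f₀ + b • f₁ := by rw [← ha, ← hb, ← hP v, hv]
    have hRve : R v = (-b) • f₀ + a • f₁ := by rw [hR' v, ha, hb]
    have hw'e : w' = a' • f₀ + b' • f₁ := by rw [← ha', ← hb', ← hP w', hw']
    have hN0 : a ^ 2 + b ^ 2 ≠ 0 := fun h0 => hv0 <| by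
      rw [hve, show a = 0 by nlinarith [sq_nonneg a, sq_nonneg b],
        show b = 0 by nlinarith [sq_nonneg a, sq_nonneg b], zero_smul, zero_smul, add_zero]
    have hN : ⦅v, v⦆ = a ^ 2 + b ^ 2 := by rw [hve, hcc]; ring
    have h1 : ⦅w', v⦆ = a * a' + b * b' := by rw [hw'e, hve, hcc]; ring
    have h2 : ⦅w', R v⦆ = a * b' - b * a' := by rw [hw'e, hRve, hcc]; ring
    rw [h1, h2, hN, hRve, hw'e, hve]
    symm
    calc ((a * a' + b * b') / (a ^ 2 + b ^ 2)) • (a • f₀ + b • f₁) +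
          ((a * b' - b * a') / (a ^ 2 + b ^ 2)) • ((-b) • f₀ + a • f₁)
        = ((a * a' + b * b') / (a ^ 2 + b ^ 2) * a - (a * b' - b * a') / (a ^ 2 + b ^ 2) * b) • f₀ +
          ((a * a' + b * b') / (a ^ 2 + b ^ 2) * b + (a * b' - b * a') / (a ^ 2 + b ^ 2) * a) • f₁ := by
          module
      _ = a' • f₀ + b' • f₁ := by congr 1 <;> congr 1 <;> field_simp <;> ring

/-- The coefficient functionals of the mixed operator are the pairings with Kirby's pair
`fᵢ = (c uᵢ, s eᵢ)`. [folklore] -/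
theorem mixCoeff_eq_pairing (u : Fin 2 → EuclideanSpace ℝ (Fin m)) (c s : ℝ) (i : Fin 2)
    (v : 𝔽 m) : mixCoeff u c s i v = ⦅v, KP[m, u, c, s, i]⦆ := by
  rw [mixCoeff_apply]
  simp only [real_inner_smul_right, EuclideanSpace.inner_single_right, one_mul, conj_trivial]
  rw [real_inner_comm (u i)]

/-- The mixed idempotent is the operator `v ↦ Σ B(v, fᵢ) fᵢ` of Kirby's pair. [folklore] -/
theorem mixOp_eq_pairing (u : Fin 2 → EuclideanSpace ℝ (Fin m)) (c s : ℝ) (v : 𝔽 m) :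
    mixOp u c s v = ⦅v, KP[m, u, c, s, 0]⦆ • KP[m, u, c, s, 0] +
      ⦅v, KP[m, u, c, s, 1]⦆ • KP[m, u, c, s, 1] := by
  rw [mixOp_apply, Fin.sum_univ_two, ← mixCoeff_apply, ← mixCoeff_apply, mixCoeff_eq_pairing,
    mixCoeff_eq_pairing]

/-- The collar rotation is the operator `v ↦ B(v, f₀) f₁ - B(v, f₁) f₀` of Kirby's pair.
[folklore] -/
theorem colRot_eq_pairing (u : Fin 2 → EuclideanSpace ℝ (Fin m)) (c s : ℝ) (v : 𝔽 m) :
    colRot[m, u, c, s] v = ⦅v, KP[m, u, c, s, 0]⦆ • KP[m, u, c, s, 1] -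
      ⦅v, KP[m, u, c, s, 1]⦆ • KP[m, u, c, s, 0] := by
  rw [sub_apply, ContinuousLinearMap.smulRight_apply, ContinuousLinearMap.smulRight_apply,
    mixCoeff_eq_pairing, mixCoeff_eq_pairing]

/-- Pairings of Kirby's pair: `B(fᵢ, fⱼ) = c² ⟪uᵢ, uⱼ⟫ + s² δᵢⱼ`. [folklore] -/
theorem pairing_KP (u : Fin 2 → EuclideanSpace ℝ (Fin m)) (c s : ℝ) (i j : Fin 2) :
    ⦅KP[m, u, c, s, i], KP[m, u, c, s, j]⦆ =
      c * c * ⟪u i, u j⟫ + s * s * (if i = j then 1 else 0) := by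
  simp only [real_inner_smul_left, real_inner_smul_right, EuclideanSpace.inner_single_left,
    PiLp.single_apply, conj_trivial, one_mul]
  ring

/-- **Kirby's pair is `B`-orthonormal** for `u` orthonormal and `c² + s² = 1`. [folklore] -/
theorem pairing_KP_of_orthonormal {u : Fin 2 → EuclideanSpace ℝ (Fin m)} (hu : Orthonormal ℝ u)
    {c s : ℝ} (hcs : c ^ 2 + s ^ 2 = 1) :
    ⦅KP[m, u, c, s, 0], KP[m, u, c, s, 0]⦆ = 1 ∧ ⦅KP[m, u, c, s, 0], KP[m, u, c, s, 1]⦆ = 0 ∧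
    ⦅KP[m, u, c, s, 1], KP[m, u, c, s, 1]⦆ = 1 := by
  have h00 : ⟪u 0, u 0⟫ = 1 := by rw [real_inner_self_eq_norm_sq, hu.1 0]; norm_num
  have h11 : ⟪u 1, u 1⟫ = 1 := by rw [real_inner_self_eq_norm_sq, hu.1 1]; norm_num
  refine ⟨?_, ?_, ?_⟩
  · rw [pairing_KP, h00, if_pos rfl]; linear_combination hcs
  · rw [pairing_KP, hu.2 (by decide), if_neg (by decide)]; ring
  · rw [pairing_KP, h11, if_pos rfl]; linear_combination hcs

/-- The outer rotation is `(p, q) ↦ (0, (-q₁, q₀))`. [folklore] -/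
theorem outRot_apply (v : 𝔽 m) :
    outRot[m] v = (0, EuclideanSpace.single 0 (-(v.2 1)) + EuclideanSpace.single 1 (v.2 0)) := by
  ext1
  · simp [mixCoeff_apply]
  · ext j
    fin_cases j <;> simp [mixCoeff_apply]

/-- **Matching on the outer boundary of the collar**: at the angle `(0, 1)` the collar rotation
is the outer rotation. [folklore] -/
theorem colRot_zero_one (u : Fin 2 → EuclideanSpace ℝ (Fin m)) :
    colRot[m, u, (0 : ℝ), (1 : ℝ)] = outRot[m] :=
  ContinuousLinearMap.ext fun v => by rw [colRot_eq_pairing, colRot_eq_pairing]; simp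

/-- The collar rotation depends continuously on its data `(u, c, s)`. [folklore] -/
theorem continuous_colRot :
    Continuous fun t : (Fin 2 → EuclideanSpace ℝ (Fin m)) × ℝ × ℝ => colRot[m, t.1, t.2.1, t.2.2] := by
  unfold mixCoeff
  fun_prop

end LinAlg

/-! ### The normal planes: `J² = -1`, unit vectors, the inner piece; gluing -/

section Normal

variable {k m : ℕ} {X : Type*} [TopologicalSpace X] [ChartedSpace (EuclideanSpace ℝ (Fin (k + 2))) X]
  [IsManifold (𝓡 (k + 2)) ∞ X]
  {S : Type*} [TopologicalSpace S] [ChartedSpace (EuclideanSpace ℝ (Fin k)) S] [IsManifold (𝓡 k) ∞ S]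
  {D : CodimTwoData k X S (EuclideanSpace ℝ (Fin m))}
  {J : S → EuclideanSpace ℝ (Fin m) →L[ℝ] EuclideanSpace ℝ (Fin m)}

/-- **A rotation field squares to `-1` on the normal planes**: polarising `⟪J v, v⟫ = 0` gives
`⟪J (J u), u⟫ = -‖J u‖² = -‖u‖²`, and `‖J (J u)‖ = ‖u‖`, so `‖J (J u) + u‖ = 0`. [folklore] -/
theorem rot_apply_apply (hJ : D.IsRotationField J) (y : S) {u : EuclideanSpace ℝ (Fin m)}
    (hu : u ∈ D.F y) : J y (J y u) = -u := by
  have hw : J y u ∈ D.F y := hJ.apply_mem y u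
  have h0 := hJ.inner_apply_self y _ (add_mem hu hw)
  rw [map_add, inner_add_left, inner_add_right, inner_add_right, hJ.inner_apply_self y u hu,
    hJ.inner_apply_self y _ hw, real_inner_self_eq_norm_sq, hJ.norm_apply y u hu] at h0
  have hn : ‖J y (J y u)‖ = ‖u‖ := by rw [hJ.norm_apply y _ hw, hJ.norm_apply y u hu]
  have h2 : ‖J y (J y u) + u‖ ^ 2 = 0 := by rw [norm_add_sq_real, hn]; linarith
  rw [sq_eq_zero_iff, norm_eq_zero] at h2
  exact eq_neg_of_add_eq_zero_left h2

variable (D) in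
/-- The normal planes contain unit vectors (`dim F = 2`). [folklore] -/
theorem exists_unit_mem_F (y : S) : ∃ u ∈ D.F y, ‖u‖ = 1 := by
  have hne : D.F y ≠ ⊥ := fun h => by
    have h2 : finrank ℝ (D.F y) = 2 := D.finrank_F_eq_two y
    rw [h, finrank_bot] at h2
    exact absurd h2 (by norm_num)
  obtain ⟨b, hb, hb0⟩ := Submodule.exists_mem_ne_zero_of_ne_bot hne
  refine ⟨‖b‖⁻¹ • b, Submodule.smul_mem _ _ hb, ?_⟩
  rw [norm_smul, norm_inv, norm_norm, inv_mul_cancel₀ (norm_ne_zero_iff.2 hb0)]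

/-- **Inner piece in collar form**: for `u = (u₀, J u₀)`, `u₀ ∈ F_y` a unit vector, `u` is
orthonormal, `inOp Q_y = mixOp u 1 0` (`Q_y = Σ ⟪uᵢ, ·⟫ uᵢ` as `dim F = 2`), and
`inOp (J_y ∘ Q_y)` is the collar rotation of `u` at the angle `(1, 0)` (`J² = -1`). [folklore] -/
theorem inner_ops (hJ : D.IsRotationField J) (y : S) {u : Fin 2 → EuclideanSpace ℝ (Fin m)}
    (hu0 : u 0 ∈ D.F y) (hn : ‖u 0‖ = 1) (hu1 : u 1 = J y (u 0)) :
    Orthonormal ℝ u ∧ inOp (D.Q y) = mixOp u 1 0 ∧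
      inOp ((J y).comp (D.Q y)) = colRot[m, u, (1 : ℝ), (0 : ℝ)] := by
  have hmem : ∀ i, u i ∈ D.F y := fun i => by
    fin_cases i
    exacts [hu0, by simpa [hu1] using hJ.apply_mem y (u 0)]
  have hon : Orthonormal ℝ u := orthonormal_iff_ite.2 fun i j => by
    fin_cases i <;> fin_cases j <;> simp [hu1, hn, hJ.inner_self_apply y hu0,
      hJ.inner_apply_self y (u 0) hu0, hJ.norm_apply y (u 0) hu0]
  have hQ : ∀ p, D.Q y p = ⟪u 0, p⟫ • u 0 + ⟪u 1, p⟫ • u 1 := fun p => by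
    have h := starProjection_eq_sum_inner_smul_of_orthonormal (D.finrank_F_eq_two y) hon hmem p
    rw [Fin.sum_univ_two] at h
    exact h
  refine ⟨hon, ContinuousLinearMap.ext fun v => ?_, ContinuousLinearMap.ext fun v => ?_⟩
  · rw [inOp_apply, mixOp_one_zero, Fin.sum_univ_two, hQ]
  · rw [inOp_apply, ContinuousLinearMap.comp_apply, hQ, map_add, map_smul, map_smul, sub_apply,
      ContinuousLinearMap.smulRight_apply, ContinuousLinearMap.smulRight_apply, mixCoeff_apply,
      mixCoeff_apply, hu1, rot_apply_apply hJ y hu0, smul_neg, ← sub_eq_add_neg]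
    ext1 <;> simp

/-- **Gluing lemma** (the tree's `continuousOn_planeField`, run on `W = e(X) ∪ {dist > δ}`):
`A` within `δ/2` of `f(S)`, `M` on the collar, the constant `O` beyond `δ` glue to a function
continuous on `W` if `A` is continuous on the metric tube, `M` on the collar set of `e(X)`, and
the pieces agree on the interfaces. [folklore] -/
theorem continuousOn_glue [CompactSpace S] [Nonempty S] {T : Type*} [TopologicalSpace T]
    {A M : EuclideanSpace ℝ (Fin m) → T} {O : T} {ε δ δ₀ : ℝ} (hδ : 0 < δ) (hδδ₀ : δ < δ₀)
    (hδ₀ε : δ₀ ≤ ε) (hA : ContinuousOn A {z | infDist z D.img < ε})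
    (hM : ContinuousOn M {z | infDist z D.img ≤ δ ∧ 0 < infDist z D.img ∧ z ∈ range D.e})
    (h1 : ∀ z ∈ range D.e, infDist z D.img = δ / 2 → A z = M z)
    (h2 : ∀ z, infDist z D.img = δ → M z = O) :
    ContinuousOn (fun z => if infDist z D.img ≤ δ / 2 then A z
      else if infDist z D.img ≤ δ then M z else O) (range D.e ∪ {z | δ < infDist z D.img}) := by
  have hρ : Continuous fun z : EuclideanSpace ℝ (Fin m) => infDist z D.img := continuous_infDist_pt _
  have hcl : ∀ r : ℝ, closure {z : EuclideanSpace ℝ (Fin m) | infDist z D.img ≤ r} =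
      {z | infDist z D.img ≤ r} := fun r => (isClosed_le hρ continuous_const).closure_eq
  have hWe : ∀ z ∈ range D.e ∪ {z | δ < infDist z D.img}, infDist z D.img ≤ δ → z ∈ range D.e :=
    fun z hz h => hz.resolve_right fun h' => absurd h (not_le.2 h')
  refine ContinuousOn.if ?_ ?_ ?_
  · rintro z ⟨hzW, hfr⟩
    have hzδ : infDist z D.img = δ / 2 := frontier_le_subset_eq hρ continuous_const hfr
    rw [if_pos (by linarith)]
    exact h1 z (hWe z hzW (by linarith)) hzδ
  · refine hA.mono ?_
    rw [hcl]
    rintro z ⟨-, hz⟩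
    exact lt_of_le_of_lt (show infDist z D.img ≤ δ / 2 from hz) (by linarith)
  · refine ContinuousOn.if ?_ ?_ continuousOn_const
    · rintro z ⟨-, hz⟩
      exact h2 z (frontier_le_subset_eq hρ continuous_const hz)
    · refine hM.mono ?_
      rintro z ⟨⟨hzW, hz2⟩, hz3⟩
      rw [hcl] at hz3
      have h' : δ / 2 ≤ infDist z D.img :=
        closure_lt_subset_le continuous_const hρ (by simpa [not_le] using hz2)
      exact ⟨hz3, by linarith, hWe z hzW hz3⟩

end Normal

end HelperPlaneFieldRotation

open HelperPlaneFieldRotation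

/-- **Kirby's plane field carries a continuous rotation field** (helper for
`stub_normalWitnessTransfer`): on `W = e(X) ∪ {dist(·, f S) > δ}` the plane field `D.planeField J ε δ`
is continuous and there is a field of endomorphisms `Rot`, continuous on `W`, forming with it an
oriented plane field at every point of `W`, equal to `(p, q) ↦ (J Q p, 0)` within `δ/2` of `f(S)`
and to `(p, q) ↦ (0, (-q₁, q₀))` beyond `δ`. [cite: Kirby1989, Ch. VIII, proof of Thm. 2, pp. 44–45] -/
theorem helper_planeFieldRotation : ∀ (k m : ℕ) (X : Type) [TopologicalSpace X] [ChartedSpace (EuclideanSpace ℝ (Fin (k + 2))) X] [IsManifold (𝓡 (k + 2)) ∞ X] (S : Type) [TopologicalSpace S] [ChartedSpace (EuclideanSpace ℝ (Fin k)) S] [IsManifold (𝓡 k) ∞ S] [CompactSpace S] [Nonempty S] (D : Literature.Topology.FourManifolds.CodimTwoData k X S (EuclideanSpace ℝ (Fin m))) (J : S → EuclideanSpace ℝ (Fin m) →L[ℝ] EuclideanSpace ℝ (Fin m)) (ε δ δ₀ : ℝ), D.IsRotationField J → D.IsTubeRadius ε → 0 < δ → δ < δ₀ → δ₀ ≤ ε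 → (∀ q : X, 0 < Metric.infDist (D.e q) D.img → Metric.infDist (D.e q) D.img < δ₀ → D.wVec ε (D.e q) ≠ 0) → ContinuousOn (D.planeField J ε δ) (Set.range D.e ∪ {z | δ < Metric.infDist z D.img}) ∧ ∃ Rot : EuclideanSpace ℝ (Fin m) → (EuclideanSpace ℝ (Fin m) × EuclideanSpace ℝ (Fin 2)) →L[ℝ] (EuclideanSpace ℝ (Fin m) × EuclideanSpace ℝ (Fin 2)), ContinuousOn Rot (Set.range D.e ∪ {z | δ < Metric.infDist z D.img}) ∧ (∀ z ∈ Set.range D.e ∪ {z | δ < Metric.infDist z D.img}, (∀ v, D.planeField J ε δ z (D.planeField J ε δ z v) = D.planeField J ε δ z v) ∧ (∀ v, D.planeField J ε δ z (Rot z v) = Rot z v) ∧ (∀ v, Rot z (D.planeField J ε δ z v) = Rot z v) ∧ (∀ v, Rot z (Rot z v) = - D.planeField J ε δ z v) ∧ (∀ v, inner ℝ (Rot z v).1 (D.planeField J ε δ z v).1 + inner ℝ (Rot z v).2 (D.planeField J ε δ z v).2 = 0) ∧ (∀ v, inner ℝ (Rot z v).1 (Rot z v).1 + inner ℝ (Rot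 z v).2 (Rot z v).2 = inner ℝ (D.planeField J ε δ z v).1 (D.planeField J ε δ z v).1 + inner ℝ (D.planeField J ε δ z v).2 (D.planeField J ε δ z v).2) ∧ D.planeField J ε δ z ≠ 0 ∧ (∀ v w', D.planeField J ε δ z v = v → v ≠ 0 → D.planeField J ε δ z w' = w' → w' = ((inner ℝ w'.1 v.1 + inner ℝ w'.2 v.2) / (inner ℝ v.1 v.1 + inner ℝ v.2 v.2)) • v + ((inner ℝ w'.1 (Rot z v).1 + inner ℝ w'.2 (Rot z v).2) / (inner ℝ v.1 v.1 + inner ℝ v.2 v.2)) • Rot z v)) ∧ (∀ z, Metric.infDist z D.img ≤ δ / 2 → ∀ v, Rot z v = (J (D.nearPt ε z) (D.Q (D.nearPt ε z) v.1), 0)) ∧ (∀ z, δ < Metric.infDist z D.img → ∀ v, Rot z v = (0, EuclideanSpace.single 0 (-(v.2 1)) + EuclideanSpace.single 1 (v.2 0))) := by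
  intro k m X _ _ _ S _ _ _ _ _ D J ε δ δ₀ hJ hε hδ hδδ₀ hδ₀ε hw0
  have hπ := D.continuousOn_nearPt hε
  have hQc : Continuous fun y : S => D.Q y := D.contMDiff_Q.continuous
  -- `wVec ≠ 0` at the points of `e(X)` in the closed collar
  have hwz : ∀ z ∈ range D.e, δ / 2 ≤ infDist z D.img → infDist z D.img ≤ δ → D.wVec ε z ≠ 0 := by
    rintro _ ⟨q, rfl⟩ h1 h2
    exact hw0 q (by linarith) (by linarith)
  -- the angle `θ = (π/2) λ` of the collar: continuity, `θ = 0` at `dist = δ/2`, `θ = π/2` at `δ`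
  have hcs : Continuous fun z : EuclideanSpace ℝ (Fin m) =>
      (Real.cos (Real.pi / 2 * D.collar δ z), Real.sin (Real.pi / 2 * D.collar δ z)) :=
    (Real.continuous_cos.comp (continuous_const.mul (continuous_collar (D := D) δ))).prodMk
      (Real.continuous_sin.comp (continuous_const.mul (continuous_collar (D := D) δ)))
  have hθ0 : ∀ z : EuclideanSpace ℝ (Fin m), infDist z D.img = δ / 2 →
      Real.pi / 2 * D.collar δ z = 0 := fun z hz => by rw [collar, hz]; field_simp; ring
  have hθ1 : ∀ z : EuclideanSpace ℝ (Fin m), infDist z D.img = δ →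
      Real.pi / 2 * D.collar δ z = Real.pi / 2 := fun z hz => by rw [collar, hz]; field_simp; ring
  refine ⟨?_, ?_⟩
  · -- continuity of the plane field on `W`
    have hA : ContinuousOn (fun z => inOp (D.Q (D.nearPt ε z))) {z | infDist z D.img < ε} :=
      (continuous_inOp.comp_continuousOn (hQc.comp_continuousOn hπ) :)
    have hM : ContinuousOn (fun z => mixOp (D.nFrame J ε z) (Real.cos (Real.pi / 2 * D.collar δ z))
        (Real.sin (Real.pi / 2 * D.collar δ z))) _ :=
      (continuous_mixOp.comp_continuousOn
        ((continuousOn_nFrame hJ hε hδδ₀ hδ₀ε hw0).prodMk hcs.continuousOn) :)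
    have h := continuousOn_glue (D := D) (O := outOp) hδ hδδ₀ hδ₀ε hA hM
      (fun z hz hzδ => by
        rw [hθ0 z hzδ, Real.cos_zero, Real.sin_zero]
        exact (mixOp_nFrame_one_zero hJ (hwz z hz (by linarith) (by linarith))).symm)
      (fun z hzδ => by
        rw [hθ1 z hzδ, Real.cos_pi_div_two, Real.sin_pi_div_two]
        exact ContinuousLinearMap.ext (mixOp_zero_one _))
    exact h
  · refine ⟨fun z => if infDist z D.img ≤ δ / 2 then
        inOp ((J (D.nearPt ε z)).comp (D.Q (D.nearPt ε z)))
      else if infDist z D.img ≤ δ then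
        colRot[m, D.nFrame J ε z, Real.cos (Real.pi / 2 * D.collar δ z),
          Real.sin (Real.pi / 2 * D.collar δ z)]
      else outRot[m], ?_, ?_, fun z hz v => by simp only [if_pos hz]; rfl, fun z hz v => ?_⟩
    · -- continuity of the rotation field on `W`
      have hA : ContinuousOn (fun z => inOp ((J (D.nearPt ε z)).comp (D.Q (D.nearPt ε z))))
          {z | infDist z D.img < ε} := (continuous_inOp.comp_continuousOn
        ((hJ.continuous.comp_continuousOn hπ).clm_comp (hQc.comp_continuousOn hπ)) :)
      have hM : ContinuousOn (fun z => colRot[m, D.nFrame J ε z, Real.cos (Real.pi / 2 * D.collar δ z),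
          Real.sin (Real.pi / 2 * D.collar δ z)]) _ := (continuous_colRot.comp_continuousOn
        ((continuousOn_nFrame hJ hε hδδ₀ hδ₀ε hw0).prodMk hcs.continuousOn) :)
      have h := continuousOn_glue (D := D) (O := outRot[m]) hδ hδδ₀ hδ₀ε hA hM
        (fun z hz hzδ => by
          rw [hθ0 z hzδ, Real.cos_zero, Real.sin_zero]
          exact (inner_ops hJ _ (nFrame_mem_F hJ z 0)
            ((orthonormal_nFrame hJ (hwz z hz (by linarith) (by linarith))).1 0) (by
              rw [show D.nFrame J ε z 0 = ‖D.wVec ε z‖⁻¹ • D.wVec ε z from rfl, map_smul]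
              rfl)).2.2)
        (fun z hzδ => by
          rw [hθ1 z hzδ, Real.cos_pi_div_two, Real.sin_pi_div_two]
          exact colRot_zero_one _)
      exact h
    · -- the axioms of an oriented plane field at `z ∈ W`: three `B`-orthonormal pairs
      intro z hz
      simp only [CodimTwoData.planeField]
      by_cases h1 : infDist z D.img ≤ δ / 2
      · simp only [if_pos h1]
        obtain ⟨u₀, hu₀, hn⟩ := exists_unit_mem_F D (D.nearPt ε z)
        obtain ⟨hon, hP, hR⟩ := inner_ops (m := m) hJ (D.nearPt ε z)
          (u := ![u₀, J (D.nearPt ε z) u₀]) hu₀ hn rfl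
        rw [hP, hR]
        obtain ⟨h00, h01, h11⟩ :=
          pairing_KP_of_orthonormal (m := m) (c := 1) (s := 0) hon (by norm_num)
        exact opf_of_pair h00 h01 h11 (mixOp_eq_pairing _ _ _) (colRot_eq_pairing _ _ _)
      · by_cases h2 : infDist z D.img ≤ δ
        · simp only [if_neg h1, if_pos h2]
          have hw := hwz z (hz.resolve_right fun h' => absurd h2 (not_le.2 h')) (by linarith) h2
          obtain ⟨h00, h01, h11⟩ := pairing_KP_of_orthonormal (m := m) (orthonormal_nFrame hJ hw)
            (Real.cos_sq_add_sin_sq (Real.pi / 2 * D.collar δ z))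
          exact opf_of_pair h00 h01 h11 (mixOp_eq_pairing _ _ _) (colRot_eq_pairing _ _ _)
        · simp only [if_neg h1, if_neg h2]
          rw [show (outOp : 𝔽 m →L[ℝ] 𝔽 m) = mixOp 0 0 1 from
            (ContinuousLinearMap.ext (mixOp_zero_one _)).symm]
          exact opf_of_pair (by rw [pairing_KP]; simp) (by rw [pairing_KP]; simp)
            (by rw [pairing_KP]; simp) (mixOp_eq_pairing _ _ _) (colRot_eq_pairing _ _ _)
    · -- outer formula
      have h1 : ¬infDist z D.img ≤ δ / 2 := fun h => by linarith
      simp only [if_neg h1, if_neg (not_le.2 hz)]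
      exact outRot_apply v

end Summit.SmoothPoincare4.SmoothPoincare4.Theorems.GromovRecognitionRelEnd.CrossCapLaurent
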